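import Mathlib.RingTheory.Unramified.Locus
import Mathlib.RingTheory.Unramified.LocalRing
import Mathlib.RingTheory.Kaehler.TensorProduct
import Mathlib.RingTheory.LocalRing.ResidueField.Fiber
import Mathlib.RingTheory.LocalRing.Module
import Mathlib.AlgebraicGeometry.Morphisms.FormallyUnramified
import Mathlib.AlgebraicGeometry.Morphisms.FiniteType
import Mathlib.AlgebraicGeometry.Fiber
import Mathlib.AlgebraicGeometry.Morphisms.LocalFlatDescent
import Mathlib.AlgebraicGeometry.Morphisms.Etale
import HarnessLib

/-!
# Unramifiedness is fibrewise (Stacks 02G8 / EGA IV 17.4.1)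

Topic `Literature/AlgebraicGeometry/Morphisms`; namespace `Literature.AlgebraicGeometry.Morphisms`.  Mathlib-only.  Cell `hodgecm-mathlib`
(D-0151), background programme «R-pkg» (VI-NOS r₂ in abelian-scheme currency), piece T1c-GENERIC (B-p20 07:46:46Z): the input B-p07's
T1c needs to read «`[N] : 𝒜 → 𝒜` is unramified over `𝓞_{K,v}`» off the two fibres `[N]_K` on `A` and `[N]_{κ(v)}` on the special fibre.
THEOREMS ONLY; no definition, no named fact, no instance; debt 0.  Pattern = Mathlib's `Smooth.of_smooth_fiberToSpecResidueField` (`Morphisms/SmoothFiber.lean`) with the ring-level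
input replaced by a direct Kähler-differential argument.

* §1 (rings) `Algebra.IsUnramifiedAt.of_formallyUnramified_fiber`: `R → S` essentially of finite type, `q` over `p`, fibre algebra
  `κ(p) ⊗[R] S` formally unramified over `κ(p)` ⇒ `S` unramified at `q` (`Ω[(κ(p) ⊗ S)⁄κ(p)] ≅ κ(p) ⊗ Ω[S⁄R]`
  (`KaehlerDifferential.tensorKaehlerEquivBase`) ⇒ `κ(q) ⊗ Ω[S⁄R] = 0` ⇒ `Ω[S_q⁄R] = 0` by Nakayama over `S_q`
  (`IsLocalRing.subsingleton_tensorProduct`, localisation of `Ω` is a base change));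
  `Algebra.FormallyUnramified.of_formallyUnramified_fiber` (all fibres ⇒ unramified, via `Algebra.formallyUnramified_iff_forall`).
* §2 (schemes) `FormallyUnramified.of_formallyUnramified_fiberToSpecResidueField`: `f : X ⟶ Y` locally of finite type with all
  scheme-theoretic fibres `X_y → Spec κ(y)` formally unramified is formally unramified; iff form
  `formallyUnramified_iff_forall_fiberToSpecResidueField`; converse `FormallyUnramified.fiberToSpecResidueField`.
* §3 (schemes over a base) `FormallyUnramified.of_formallyUnramified_pullback_map_fromSpecResidueField`: an `S`-morphism `f : X → Y`
  (`g : Y → S`) locally of finite type all of whose base changes `f ×_S Spec κ(s) = pullback.map (f ≫ g) ι g ι f (𝟙 _) (𝟙 _)`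
  (`ι = S.fromSpecResidueField s`) are formally unramified is formally unramified (fibre of `f_s` at a point over `y` = fpqc base
  change of the fibre of `f` at `y`; descent `DescendsAlong @FormallyUnramified`); `isPullback_pullback_map_fromSpecResidueField`
  (the cartesian square over `f`).

## References
* [StacksProject] The Stacks Project, Tag 02G8 (unramified morphisms and fibres), Tag 00UV.
* [EGAIV4] A. Grothendieck, J. Dieudonné, EGA IV₄ (Publ. Math. IHÉS 32, 1967), Thm. 17.4.1.
-/

set_option autoImplicit false

open TensorProduct

namespace Literature.AlgebraicGeometry.Morphisms

/-! ## §1 Rings: `R → S` essentially of finite type is unramified at `q` as soon as the fibre `κ(p) ⊗[R] S` is unramified over `κ(p)` -/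

section Ring

variable {R S : Type*} [CommRing R] [CommRing S] [Algebra R S]

/-- **The fibre criterion for unramifiedness at a prime** (Stacks 02G8 / EGA IV 17.4.1): for `R → S` essentially of finite type,
a prime `q` of `S` over `p`, if the fibre algebra `κ(p) ⊗[R] S` is formally unramified over `κ(p)` then `S` is unramified at `q`.
Proof: `Ω[S_q⁄R]` is finitely generated over the local ring `S_q`, so by Nakayama it vanishes as soon as
`κ(q) ⊗ Ω[S_q⁄R] ≅ κ(q) ⊗_S Ω[S⁄R]` does; and `κ(q) ⊗_S Ω[S⁄R]` is a base change of `κ(p) ⊗_R Ω[S⁄R] ≅ Ω[(κ(p) ⊗ S)⁄κ(p)] = 0`.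
[cite: StacksProject, Tag 02G8] [cite: EGAIV4, Thm. 17.4.1] -/
theorem Algebra.IsUnramifiedAt.of_formallyUnramified_fiber [Algebra.EssFiniteType R S]
    (p : Ideal R) (q : Ideal S) [p.IsPrime] [q.IsPrime] [q.LiesOver p]
    [Algebra.FormallyUnramified p.ResidueField (p.Fiber S)] : Algebra.IsUnramifiedAt R q := by
  -- (1) the fibre: `κ(p) ⊗[R] Ω[S⁄R] ≅ Ω[(κ(p) ⊗ S)⁄κ(p)] = 0` (the `S`-algebra structure on `κ(p) ⊗ S` through the right factor)
  have h1 : Subsingleton (p.ResidueField ⊗[R] Ω[S⁄R]) := by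
    letI : Algebra S (p.Fiber S) := Algebra.TensorProduct.rightAlgebra
    exact (KaehlerDifferential.tensorKaehlerEquivBase R p.ResidueField S (p.Fiber S)).toEquiv.subsingleton_congr.mpr
      ((Algebra.formallyUnramified_iff _ _).mp inferInstance)
  -- (2) `κ(q) ⊗[R] Ω[S⁄R] ≅ κ(q) ⊗[κ(p)] (κ(p) ⊗[R] Ω[S⁄R])` is trivial, hence so is its quotient `κ(q) ⊗[S] Ω[S⁄R]`
  let φ : p.ResidueField →ₐ[R] q.ResidueField :=
    Ideal.ResidueField.mapₐ p q (Algebra.ofId R S) (Ideal.LiesOver.over (p := p) (P := q))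
  letI : Algebra p.ResidueField q.ResidueField := φ.toRingHom.toAlgebra
  haveI : IsScalarTower R p.ResidueField q.ResidueField :=
    IsScalarTower.of_algebraMap_eq fun r => (φ.commutes r).symm
  have h2 : Subsingleton (q.ResidueField ⊗[R] Ω[S⁄R]) := by
    haveI : Subsingleton (q.ResidueField ⊗[p.ResidueField] (p.ResidueField ⊗[R] Ω[S⁄R])) := by
      refine subsingleton_of_forall_eq 0 fun x => ?_
      induction x using TensorProduct.induction_on with
      | zero => rfl
      | tmul a b => rw [Subsingleton.elim b 0, TensorProduct.tmul_zero]
      | add x y hx hy => rw [hx, hy, add_zero]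
    exact (TensorProduct.AlgebraTensorModule.cancelBaseChange R p.ResidueField p.ResidueField q.ResidueField
      (Ω[S⁄R])).symm.toEquiv.subsingleton_congr.mpr this
  have h3 : Subsingleton (q.ResidueField ⊗[S] Ω[S⁄R]) := by
    refine subsingleton_of_forall_eq 0 fun x => ?_
    obtain ⟨y, rfl⟩ := TensorProduct.mapOfCompatibleSMul_surjective S R q.ResidueField q.ResidueField (Ω[S⁄R]) x
    rw [Subsingleton.elim y 0, map_zero]
  -- (3) Nakayama over the local ring `S_q`
  let Sq := Localization.AtPrime q
  haveI : Algebra.EssFiniteType R Sq := Algebra.EssFiniteType.comp R S Sq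
  change Algebra.FormallyUnramified R Sq
  rw [Algebra.formallyUnramified_iff, ← IsLocalRing.subsingleton_tensorProduct (R := Sq)]
  -- `𝓀(S_q) ⊗[S_q] Ω[S_q⁄R] ≅ 𝓀(S_q) ⊗[S_q] (S_q ⊗[S] Ω[S⁄R]) ≅ κ(q) ⊗[S] Ω[S⁄R]`
  have hb : IsBaseChange Sq (KaehlerDifferential.map R R S Sq) :=
    IsLocalizedModule.isBaseChange q.primeCompl Sq _
  let e : IsLocalRing.ResidueField Sq ⊗[Sq] Ω[Sq⁄R] ≃ IsLocalRing.ResidueField Sq ⊗[S] Ω[S⁄R] :=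
    (TensorProduct.AlgebraTensorModule.congr
        (LinearEquiv.refl (IsLocalRing.ResidueField Sq) (IsLocalRing.ResidueField Sq)) hb.equiv.symm).toEquiv.trans
      (TensorProduct.AlgebraTensorModule.cancelBaseChange S Sq (IsLocalRing.ResidueField Sq)
        (IsLocalRing.ResidueField Sq) (Ω[S⁄R])).toEquiv
  exact e.subsingleton_congr.mpr h3

/-- **Unramifiedness is fibrewise** (rings; Stacks 02G8 / EGA IV 17.4.1): an essentially-of-finite-type `R`-algebra `S` all of
whose fibre algebras `κ(p) ⊗[R] S` are formally unramified over `κ(p)` is formally unramified over `R` (unramified = unramified at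
every prime, `Algebra.formallyUnramified_iff_forall`). [cite: StacksProject, Tag 02G8] [cite: EGAIV4, Thm. 17.4.1] -/
theorem Algebra.FormallyUnramified.of_formallyUnramified_fiber [Algebra.EssFiniteType R S]
    (H : ∀ (p : Ideal R) [p.IsPrime], Algebra.FormallyUnramified p.ResidueField (p.Fiber S)) :
    Algebra.FormallyUnramified R S := by
  rw [Algebra.formallyUnramified_iff_forall]
  intro q
  haveI := H (q.asIdeal.under R)
  exact Algebra.IsUnramifiedAt.of_formallyUnramified_fiber (q.asIdeal.under R) q.asIdeal

end Ring

/-! ## §2 Schemes: `f` locally of finite type is unramified as soon as all its fibres `X_y → Spec κ(y)` are -/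

section Scheme

open CategoryTheory CategoryTheory.Limits _root_.AlgebraicGeometry

universe u

variable {X Y : Scheme.{u}} (f : X ⟶ Y)

/-- The fibres of an unramified morphism are unramified (base change). [cite: StacksProject, Tag 02G8] -/
theorem FormallyUnramified.fiberToSpecResidueField [FormallyUnramified f] (y : Y) :
    FormallyUnramified (f.fiberToSpecResidueField y) :=
  MorphismProperty.pullback_snd (P := @FormallyUnramified) f (Y.fromSpecResidueField y) inferInstance

set_option backward.isDefEq.respectTransparency false in
/-- **Unramifiedness is fibrewise** (schemes; Stacks 02G8 / EGA IV 17.4.1): a morphism `f : X ⟶ Y` locally of finite type all of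
whose scheme-theoretic fibres `X_y → Spec κ(y)` are formally unramified is formally unramified.  Reduction to the affine case
exactly as Mathlib's `Smooth.of_smooth_fiberToSpecResidueField`, then the ring statement
`Algebra.FormallyUnramified.of_formallyUnramified_fiber`. [cite: StacksProject, Tag 02G8] [cite: EGAIV4, Thm. 17.4.1] -/
theorem FormallyUnramified.of_formallyUnramified_fiberToSpecResidueField [LocallyOfFiniteType f]
    (h : ∀ y, FormallyUnramified (f.fiberToSpecResidueField y)) :
    FormallyUnramified f := by
  wlog hY : ∃ R, Y = Spec R
  · rw [IsZariskiLocalAtTarget.iff_of_openCover (P := @FormallyUnramified) Y.affineCover]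
    intro i
    dsimp [Scheme.Cover.pullbackHom]
    refine this _ (fun y ↦ ?_) ⟨_, rfl⟩
    apply MorphismProperty.of_isPullback
    · exact isPullback_fiberToSpecResidueField_of_isPullback (IsPullback.of_hasPullback _ _) _
    · infer_instance
  obtain ⟨R, rfl⟩ := hY
  wlog hX : ∃ S, X = Spec S generalizing f X
  · rw [IsZariskiLocalAtSource.iff_of_openCover (P := @FormallyUnramified) X.affineCover]
    intro i
    have hy (y) : FormallyUnramified (pullback.snd f ((Spec R).fromSpecResidueField y)) :=
      inferInstanceAs <| FormallyUnramified (f.fiberToSpecResidueField y)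
    refine this _ (fun y ↦ ?_) ⟨_, rfl⟩
    rw [Scheme.Hom.fiberToSpecResidueField, ← pullbackRightPullbackFstIso_inv_snd_snd]
    refine MorphismProperty.comp_mem _ _ _ (MorphismProperty.of_isIso _ _)
      (MorphismProperty.comp_mem _ _ _ ?_ (hy y))
    -- a base change of the open immersion `X.affineCover.f i` is an open immersion, hence unramified
    infer_instance
  obtain ⟨S, rfl⟩ := hX
  obtain ⟨φ, rfl⟩ := Spec.map_surjective f
  have hft : φ.hom.FiniteType := by
    have := ‹LocallyOfFiniteType (Spec.map φ)›
    simpa only [HasRingHomProperty.Spec_iff] using this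
  simp only [HasRingHomProperty.Spec_iff]
  algebraize [φ.hom]
  refine Algebra.FormallyUnramified.of_formallyUnramified_fiber fun p hp ↦ ?_
  rw [← RingHom.formallyUnramified_algebraMap, ← CommRingCat.hom_ofHom (algebraMap p.ResidueField (p.Fiber ↑S)),
    ← HasRingHomProperty.Spec_iff (P := @FormallyUnramified),
    ← MorphismProperty.arrow_mk_iso_iff (P := @FormallyUnramified) (Spec.fiberToSpecResidueFieldIso R S ⟨p, hp⟩)]
  exact h ⟨p, hp⟩

/-- **Unramifiedness is fibrewise**, iff form. [cite: StacksProject, Tag 02G8] -/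
theorem formallyUnramified_iff_forall_fiberToSpecResidueField [LocallyOfFiniteType f] :
    FormallyUnramified f ↔ ∀ y, FormallyUnramified (f.fiberToSpecResidueField y) :=
  ⟨fun _ y => FormallyUnramified.fiberToSpecResidueField f y,
    FormallyUnramified.of_formallyUnramified_fiberToSpecResidueField f⟩

/-! ## §3 Schemes over a base: `f : X → Y` over `S` is unramified as soon as every base change `f ×_S Spec κ(s)` is -/

variable {S : Scheme.{u}} (g : Y ⟶ S)

/-- `f_s` sits in the cartesian square over `f` (transitivity of fibre products). [cite: StacksProject, Tag 02G8] -/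
theorem isPullback_pullback_map_fromSpecResidueField (s : S) :
    IsPullback (pullback.fst (f ≫ g) (S.fromSpecResidueField s))
      (pullback.map (f ≫ g) (S.fromSpecResidueField s) g (S.fromSpecResidueField s) f (𝟙 _) (𝟙 _)
        (Category.comp_id _).symm (by rw [Category.comp_id, Category.id_comp]))
      f (pullback.fst g (S.fromSpecResidueField s)) := by
  refine (IsPullback.of_right
    (h₁₁ := pullback.map (f ≫ g) (S.fromSpecResidueField s) g (S.fromSpecResidueField s) f (𝟙 _) (𝟙 _)
      (Category.comp_id _).symm (by rw [Category.comp_id, Category.id_comp]))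
    (h₁₂ := pullback.snd g (S.fromSpecResidueField s))
    (v₁₁ := pullback.fst (f ≫ g) (S.fromSpecResidueField s)) (v₁₂ := pullback.fst g (S.fromSpecResidueField s))
    (v₁₃ := S.fromSpecResidueField s) (h₂₁ := f) (h₂₂ := g) ?_ ?_ (IsPullback.of_hasPullback g _).flip).flip
  · have e : pullback.map (f ≫ g) (S.fromSpecResidueField s) g (S.fromSpecResidueField s) f (𝟙 _) (𝟙 _)
          (Category.comp_id _).symm (by rw [Category.comp_id, Category.id_comp]) ≫
        pullback.snd g (S.fromSpecResidueField s) = pullback.snd (f ≫ g) (S.fromSpecResidueField s) := by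
      simp only [pullback.lift_snd, Category.comp_id]
    rw [e]
    exact (IsPullback.of_hasPullback (f ≫ g) (S.fromSpecResidueField s)).flip
  · simp only [pullback.lift_fst]

set_option backward.isDefEq.respectTransparency false in
/-- **Unramifiedness is fibrewise over a base** (Stacks 02G8 / EGA IV 17.4.1 in the relative form): an `S`-morphism `f : X → Y`
locally of finite type such that every base change `f ×_S Spec κ(s) : X_s → Y_s` to the residue field of a point `s ∈ S` is
formally unramified is formally unramified.  Proof: for `y ∈ Y` over `s`, pick the point `y₁ ∈ Y_s` over `y`; the fibre of `f_s`
at `y₁` (unramified) is the base change of the fibre of `f` at `y` along `Spec κ(y₁) → Spec κ(y)`, a quasi-compact faithfully flat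
morphism, so the fibre of `f` at `y` is unramified by fpqc descent (`DescendsAlong @FormallyUnramified`); conclude by the fibrewise
criterion over `Y`. [cite: StacksProject, Tag 02G8] [cite: EGAIV4, Thm. 17.4.1] -/
theorem FormallyUnramified.of_formallyUnramified_pullback_map_fromSpecResidueField [LocallyOfFiniteType f]
    (h : ∀ s : S, FormallyUnramified (pullback.map (f ≫ g) (S.fromSpecResidueField s) g (S.fromSpecResidueField s) f
      (𝟙 _) (𝟙 _) (Category.comp_id _).symm (by rw [Category.comp_id, Category.id_comp]))) :
    FormallyUnramified f := by
  refine FormallyUnramified.of_formallyUnramified_fiberToSpecResidueField f fun y => ?_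
  -- a point `y₁` of `Y_s` over `y`, `s = g y`
  have hpt : g (y) = (S.fromSpecResidueField (g.base y))
      (IsLocalRing.closedPoint (S.residueField (g.base y)) : Spec (S.residueField (g.base y))) := by
    rw [Scheme.fromSpecResidueField_apply]
  obtain ⟨y₁, hy₁, -⟩ := Scheme.Pullback.exists_preimage_pullback (f := g)
    (g := S.fromSpecResidueField (g.base y)) y _ hpt
  -- the fibre of `f_s` at `y₁` is the base change of the fibre of `f` at `y` along `Spec κ(y₁) → Spec κ(y)`
  have hsq := isPullback_fiberToSpecResidueField_of_isPullback
    (isPullback_pullback_map_fromSpecResidueField f g (g.base y)) y₁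
  haveI := h (g.base y)
  have hy : (pullback.fst g (S.fromSpecResidueField (g.base y))).base y₁ = y := hy₁
  -- descent along the fpqc cover `Spec κ(y₁) → Spec κ(y)`
  have hQ : (@Surjective ⊓ @Flat ⊓ @QuasiCompact : MorphismProperty Scheme)
      (Spec.map ((pullback.fst g (S.fromSpecResidueField (g.base y))).residueFieldMap y₁)) :=
    ⟨⟨inferInstance, inferInstance⟩, inferInstance⟩
  have key := MorphismProperty.of_isPullback_of_descendsAlong (P := @FormallyUnramified) hsq.flip hQ
    (FormallyUnramified.fiberToSpecResidueField _ y₁)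
  rwa [hy] at key

/-! ## §4 The same with ARBITRARY field-valued points of the base (appended): fpqc descent along `Spec K → Spec κ(s)` -/

/-- The base change `f ×_S T` of an `S`-morphism `f : X → Y` along any `i : T ⟶ S` sits in a cartesian square over `f`
(transitivity of fibre products). [cite: StacksProject, Tag 02G8] -/
theorem isPullback_pullback_map_base {T : Scheme.{u}} (i : T ⟶ S) :
    IsPullback (pullback.fst (f ≫ g) i)
      (pullback.map (f ≫ g) i g i f (𝟙 _) (𝟙 _) (Category.comp_id _).symm (by rw [Category.comp_id, Category.id_comp]))
      f (pullback.fst g i) := by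
  refine (IsPullback.of_right
    (h₁₁ := pullback.map (f ≫ g) i g i f (𝟙 _) (𝟙 _) (Category.comp_id _).symm (by rw [Category.comp_id, Category.id_comp]))
    (h₁₂ := pullback.snd g i) (v₁₁ := pullback.fst (f ≫ g) i) (v₁₂ := pullback.fst g i) (v₁₃ := i) (h₂₁ := f) (h₂₂ := g)
    ?_ ?_ (IsPullback.of_hasPullback g _).flip).flip
  · have e : pullback.map (f ≫ g) i g i f (𝟙 _) (𝟙 _) (Category.comp_id _).symm (by rw [Category.comp_id, Category.id_comp]) ≫
        pullback.snd g i = pullback.snd (f ≫ g) i := by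
      simp only [pullback.lift_snd, Category.comp_id]
    rw [e]
    exact (IsPullback.of_hasPullback (f ≫ g) i).flip
  · simp only [pullback.lift_fst]

/-- For `i = j ≫ i'` the base change `Y ×_S T → Y ×_S T'` is the base change of `j` along `Y ×_S T' → T'`. [cite: StacksProject, Tag 02G8] -/
theorem isPullback_pullback_map_comp {T T' : Scheme.{u}} (j : T ⟶ T') (i' : T' ⟶ S) (i : T ⟶ S) (hi : j ≫ i' = i) :
    IsPullback (pullback.map g i g i' (𝟙 _) j (𝟙 _) (by rw [Category.comp_id, Category.id_comp]) (by rw [Category.comp_id, hi]))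
      (pullback.snd g i) (pullback.snd g i') j := by
  subst hi
  refine IsPullback.of_right (h₁₁ := pullback.map g (j ≫ i') g i' (𝟙 _) j (𝟙 _) (by rw [Category.comp_id, Category.id_comp])
      (by rw [Category.comp_id]))
    (h₁₂ := pullback.fst g i') (v₁₁ := pullback.snd g (j ≫ i')) (v₁₂ := pullback.snd g i') (v₁₃ := g) (h₂₁ := j) (h₂₂ := i')
    ?_ ?_ (IsPullback.of_hasPullback g i')
  · have e : pullback.map g (j ≫ i') g i' (𝟙 _) j (𝟙 _) (by rw [Category.comp_id, Category.id_comp]) (by rw [Category.comp_id]) ≫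
        pullback.fst g i' = pullback.fst g (j ≫ i') := by simp only [pullback.lift_fst, Category.comp_id]
    rw [e]
    exact IsPullback.of_hasPullback g (j ≫ i')
  · simp only [pullback.lift_snd]

set_option backward.isDefEq.respectTransparency false in
/-- **Unramifiedness is fibrewise over a base, tested at ARBITRARY field-valued points** (Stacks 02G8 / EGA IV 17.4.1): an
`S`-morphism `f : X → Y` locally of finite type is formally unramified as soon as for every point `s ∈ S` there is SOME field `K` and
a morphism `i : Spec K → S` hitting `s` such that the base change `f ×_S Spec K` is formally unramified (e.g. for `S = Spec R` a
local domain: `Spec (Frac R) → S` and `Spec (R⧸𝔪) → S`).  Proof: `i` factors as `Spec K → Spec κ(s) → S`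
(`Scheme.SpecToEquivOfField`); `f ×_S Spec K` is the base change of `f ×_S Spec κ(s)` along the quasi-compact faithfully flat
`Y ×_S Spec K → Y ×_S Spec κ(s)`, so `f ×_S Spec κ(s)` is formally unramified by fpqc descent (`DescendsAlong @FormallyUnramified`),
and `of_formallyUnramified_pullback_map_fromSpecResidueField` concludes. [cite: StacksProject, Tag 02G8] [cite: EGAIV4, Thm. 17.4.1] -/
theorem FormallyUnramified.of_formallyUnramified_pullback_map_of_field_points [LocallyOfFiniteType f]
    (h : ∀ s : S, ∃ (K : Type u) (_ : Field K) (i : Spec (.of K) ⟶ S),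
      i.base (IsLocalRing.closedPoint K) = s ∧
        FormallyUnramified (pullback.map (f ≫ g) i g i f (𝟙 _) (𝟙 _) (Category.comp_id _).symm
          (by rw [Category.comp_id, Category.id_comp]))) :
    FormallyUnramified f := by
  refine FormallyUnramified.of_formallyUnramified_pullback_map_fromSpecResidueField f g fun s => ?_
  obtain ⟨K, _, i, hs, hunr⟩ := h s
  subst hs
  -- `i = Spec φ ≫ ι` through the residue field of `s = i(pt)`
  have hfac : Spec.map (S.descResidueField (Scheme.stalkClosedPointTo i)) ≫
      S.fromSpecResidueField (i.base (IsLocalRing.closedPoint K)) = i :=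
    Scheme.descResidueField_stalkClosedPointTo_fromSpecResidueField K S i
  set ι := S.fromSpecResidueField (i.base (IsLocalRing.closedPoint K)) with hι
  set φ := S.descResidueField (Scheme.stalkClosedPointTo i) with hφ
  -- the squares: `f_i` over `f`, `f_ι` over `f`, and the comparison `m : Y_i → Y_ι`
  have hX := isPullback_pullback_map_base f g i
  have hXι := isPullback_pullback_map_base f g ι
  set m := pullback.map g i g ι (𝟙 _) (Spec.map φ) (𝟙 _) (by rw [Category.comp_id, Category.id_comp])
    (by rw [Category.comp_id, hfac]) with hmdef
  have hm : IsPullback m (pullback.snd g i) (pullback.snd g ι) (Spec.map φ) :=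
    isPullback_pullback_map_comp g (Spec.map φ) ι i hfac
  -- `f_i` is the base change of `f_ι` along `m`: the induced map `n : X_i → X_ι` and the pasted square
  have hm' : m ≫ pullback.fst g ι = pullback.fst g i := by
    rw [hmdef]
    simp only [pullback.lift_fst, Category.comp_id]
  have w : pullback.fst (f ≫ g) i ≫ f =
      (pullback.map (f ≫ g) i g i f (𝟙 _) (𝟙 _) (Category.comp_id _).symm (by rw [Category.comp_id, Category.id_comp]) ≫ m) ≫
        pullback.fst g ι := by
    rw [Category.assoc, hm', hX.w]
  have hn : hXι.lift _ _ w ≫ pullback.fst (f ≫ g) ι = pullback.fst (f ≫ g) i := hXι.lift_fst _ _ w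
  have hn' : hXι.lift _ _ w ≫ pullback.map (f ≫ g) ι g ι f (𝟙 _) (𝟙 _) (Category.comp_id _).symm
      (by rw [Category.comp_id, Category.id_comp]) =
      pullback.map (f ≫ g) i g i f (𝟙 _) (𝟙 _) (Category.comp_id _).symm (by rw [Category.comp_id, Category.id_comp]) ≫ m :=
    hXι.lift_snd _ _ w
  have s' : IsPullback (hXι.lift _ _ w ≫ pullback.fst (f ≫ g) ι)
      (pullback.map (f ≫ g) i g i f (𝟙 _) (𝟙 _) (Category.comp_id _).symm (by rw [Category.comp_id, Category.id_comp]))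
      f (m ≫ pullback.fst g ι) := by
    rw [hn, hm']
    exact hX
  have hsq := IsPullback.of_right s' hn' hXι
  -- `m` is quasi-compact faithfully flat (a base change of `Spec K → Spec κ(s)`), so `f_ι` is unramified by fpqc descent
  have hQ : (@Surjective ⊓ @Flat ⊓ @QuasiCompact : MorphismProperty Scheme) m :=
    ⟨⟨MorphismProperty.of_isPullback hm.flip inferInstance, MorphismProperty.of_isPullback hm.flip inferInstance⟩,
      MorphismProperty.of_isPullback hm.flip inferInstance⟩
  exact MorphismProperty.of_isPullback_of_descendsAlong (P := @FormallyUnramified) hsq.flip hQ hunr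

end Scheme

end Literature.AlgebraicGeometry.Morphisms
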